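import Summits.HodgeConjecture.HodgeConjecture.Theorems.Q8SymplecticPowersQuaternionicTensorFFTMatrix
import Summits.HodgeConjecture.HodgeConjecture.Theorems.Q8SymplecticPowersCommutatorAscent
import Summits.HodgeConjecture.HodgeConjecture.Theorems.Q8SymplecticPowersMatchingFreeSlots
import HarnessLib

/-!
# Route `Q8SymplecticPowers`, programme K2Q ∕ F-Q — brick F2c-1: **a rational coefficient tensor fixed by the rational
# commutators of the quaternionic-unitary centraliser is a `ℚ`-combination of quaternionic tagged contractions**

Support file for crux K2Q `PowersHodgeOfQuaternionCommutators` (stmt-HodgeConjecture-24191; `--supports … --as helper`;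
nothing here closes an item). Prover seat `hodge-nonav-20241-p1` (g21). Pure linear algebra over `ℚ` ∕ `ℂ`.

`mem_span_taggedContraction_rat` — for rational matrices `S, T, G ∈ M_n(ℚ)` with `S² = T² = −1`, `ST = −TS`, `SᵀGS = G`,
`TᵀGT = G`, `Gᵀ = G`, `det G ≠ 0` (the matrices of `τ^*|_T`, `j^*|_T` and of the intersection form on the transcendental
part `T` of `H²` of the route's surface, in a basis of `T`), a RATIONAL coefficient tensor `s : (Fin m → Fin n) → ℚ` fixed by
the Kronecker powers of all commutators `g h g⁻¹ h⁻¹` of RATIONAL points `g, h` of the centraliser group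
`C = {γ : γS = Sγ, γT = Tγ, γᵀGγ = G}` lies in the `ℚ`-span of the tagged contractions
`w ↦ ∏_c (D_{δ c} G⁻¹)(w(e⁻¹(0,c)), w(e⁻¹(1,c)))`, `D ∈ {1, S, T, ST}`.  Composition of three landed bricks:
ASC-Q (`Q8SymplecticPowersCommutatorAscent.commutator_invariance_ascends₂`, p709049: invariance ascends from rational
commutators to the commutators of complex CAYLEY points of `C`), F1D
(`Q8SymplecticPowersQuaternionicTensorFFTMatrix.mem_span_taggedContraction_of_cayley_commutator_matrices`: over `ℂ ∋ i`
these invariants are spanned by the tagged contractions) and the descent `ℂ → ℚ` of function spans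
(`Q8SymplecticPowersMatchingFreeSlots.mem_span_of_algebraMap_mem_span`, p719194).

HONEST FRAMING: linear algebra only (axioms standard); item 24191 OPEN; nothing here says HC ∕ HC_CM ∕ HC_AV is proved.

## References

* R. Goodman, N. Wallach, *Symmetry, Representations, and Invariants*, GTM 255, §5.3.2 Thm. 5.3.3, §11.2.1–11.2.3 (Cayley
  parametrisation), §4.2.2 Prop. 4.2.5. [cite: GoodmanWallachGTM255]
-/

set_option linter.dupNamespace false

noncomputable section

open Module Matrix
open scoped BigOperators Matrix

namespace Summit.HodgeConjecture.HodgeConjecture.Theorems.Q8SymplecticPowersQuaternionicSliceSpan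

open Literature.RepresentationTheory.ClassicalInvariants (taggedContraction taggedContraction_apply)
open Literature.NumberTheory.DiophantineGeometry (tensorPowerMatrix)
open Summit.HodgeConjecture.HodgeConjecture.Theorems.Q8SymplecticPowersQuaternionicTensorFFTMatrix
  (mem_span_taggedContraction_of_cayley_commutator_matrices)
open Summit.HodgeConjecture.HodgeConjecture.Theorems.Q8SymplecticPowersCommutatorAscent (commutator_invariance_ascends₂)
open Summit.HodgeConjecture.HodgeConjecture.Theorems.Q8SymplecticPowersMatchingFreeSlots (mem_span_of_algebraMap_mem_span)

variable {n : ℕ}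

/-- `A² = −1` gives `A⁴ = 1`. [folklore] -/
theorem pow_four_eq_one_of_mul_self {R : Type*} [Ring R] {A : R} (h : A * A = -1) : A ^ 4 = 1 := by
  rw [show (4 : ℕ) = 2 + 2 from rfl, pow_add, pow_two, h, neg_mul_neg, one_mul]

/-- `A² = −1` gives `A⁻¹ = −A` for a square matrix. [folklore] -/
theorem inv_eq_neg_of_mul_self {K : Type*} [Field K] {A : Matrix (Fin n) (Fin n) K} (h : A * A = -1) : A⁻¹ = -A :=
  Matrix.inv_eq_left_inv (by rw [Matrix.neg_mul, h, neg_neg])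

/-- The quaternion table gives `T⁻¹ S T = S⁻¹`. [folklore] -/
theorem inv_mul_mul_eq_inv {K : Type*} [Field K] {S T : Matrix (Fin n) (Fin n) K} (hS : S * S = -1) (hT : T * T = -1)
    (hST : S * T = -(T * S)) : T⁻¹ * S * T = S⁻¹ := by
  rw [inv_eq_neg_of_mul_self hT, inv_eq_neg_of_mul_self hS, Matrix.neg_mul, Matrix.neg_mul, Matrix.mul_assoc, hST,
    Matrix.mul_neg, ← Matrix.mul_assoc, hT, Matrix.neg_mul, Matrix.one_mul, neg_neg]

/-- Mapping a tagged contraction entrywise along a ring map. [cite: GoodmanWallachGTM255, §5.3.2] -/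
theorem taggedContraction_map {K L : Type*} [Field K] [Field L] (φ : K →+* L) {ι : Type*} (Θ : ι → Matrix (Fin n) (Fin n) K)
    {m j : ℕ} (e : Fin m ≃ Fin 2 × Fin j) (δ : Fin j → ι) :
    taggedContraction (fun d => (Θ d).map φ) e δ = fun v => φ (taggedContraction Θ e δ v) := by
  funext v
  rw [taggedContraction_apply, taggedContraction_apply, map_prod]
  rfl

/-- The inverse of a mapped invertible matrix is the mapped inverse. [folklore] -/
theorem map_inv_of_isUnit {K L : Type*} [Field K] [Field L] (φ : K →+* L) {G : Matrix (Fin n) (Fin n) K}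
    (hG : IsUnit G.det) : (G.map φ)⁻¹ = G⁻¹.map φ :=
  Matrix.inv_eq_left_inv (by rw [← Matrix.map_mul, Matrix.nonsing_inv_mul G hG, Matrix.map_one φ (map_zero φ) (map_one φ)])

/-- The four quaternion units, mapped. [folklore] -/
theorem vecCons_map {K L : Type*} [Field K] [Field L] (φ : K →+* L) (S T : Matrix (Fin n) (Fin n) K) (d : Fin 4) :
    ((![(1 : Matrix (Fin n) (Fin n) K), S, T, S * T] : Fin 4 → Matrix (Fin n) (Fin n) K) d).map φ =
      (![(1 : Matrix (Fin n) (Fin n) L), S.map φ, T.map φ, S.map φ * T.map φ] : Fin 4 → Matrix (Fin n) (Fin n) L) d := by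
  fin_cases d
  · exact Matrix.map_one φ (map_zero φ) (map_one φ)
  · rfl
  · rfl
  · exact Matrix.map_mul

/-- **Brick F2c-1.** A rational coefficient tensor on `Fin m` positions fixed by the Kronecker powers of the commutators of
the rational points of the quaternionic-unitary centraliser `C = {γ : γS = Sγ, γT = Tγ, γᵀGγ = G}` (`S² = T² = −1`,
`ST = −TS`, `S, T` isometries of the symmetric invertible `G`) is a `ℚ`-linear combination of the quaternionic tagged
contractions `w ↦ ∏_c (D_{δ c} G⁻¹)(w(e⁻¹(0,c)), w(e⁻¹(1,c)))`, `D ∈ {1, S, T, ST}`.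
[cite: GoodmanWallachGTM255, §5.3.2 Thm. 5.3.3 and §11.2.1–11.2.3] -/
theorem mem_span_taggedContraction_rat {m : ℕ} (S T G : Matrix (Fin n) (Fin n) ℚ)
    (hS : S * S = -1) (hT : T * T = -1) (hST : S * T = -(T * S)) (hSG : Sᵀ * G * S = G) (hTG : Tᵀ * G * T = G)
    (hGt : Gᵀ = G) (hG : IsUnit G.det) (s : (Fin m → Fin n) → ℚ)
    (hs : ∀ g h : Matrix (Fin n) (Fin n) ℚ, IsUnit g.det → IsUnit h.det → g * S = S * g → h * S = S * h →
      g * T = T * g → h * T = T * h → gᵀ * G * g = G → hᵀ * G * h = G →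
      tensorPowerMatrix ℚ n m (g * h * g⁻¹ * h⁻¹) *ᵥ s = s) :
    s ∈ Submodule.span ℚ {f : (Fin m → Fin n) → ℚ | ∃ (j : ℕ) (e : Fin m ≃ Fin 2 × Fin j) (δ : Fin j → Fin 4),
      f = taggedContraction (fun d : Fin 4 => (![(1 : Matrix (Fin n) (Fin n) ℚ), S, T, S * T] : Fin 4 → _) d * G⁻¹) e δ} := by
  classical
  set φ : ℚ →+* ℂ := algebraMap ℚ ℂ with hφ
  -- ASC-Q: invariance under the commutators of the complex Cayley points of `C`
  have hasc := commutator_invariance_ascends₂ (r := m) (K := ℂ) S T G (p := 4) (q := 4) (by norm_num) (by norm_num)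
    (pow_four_eq_one_of_mul_self hS) (pow_four_eq_one_of_mul_self hT) hSG hTG (inv_mul_mul_eq_inv hS hT hST) hGt hG s hs
  -- F1D over `ℂ`
  have hA : S.map φ * S.map φ = -1 := by
    rw [← Matrix.map_mul, hS, Matrix.map_neg _ (map_neg φ), Matrix.map_one φ (map_zero φ) (map_one φ)]
  have hB : T.map φ * T.map φ = -1 := by
    rw [← Matrix.map_mul, hT, Matrix.map_neg _ (map_neg φ), Matrix.map_one φ (map_zero φ) (map_one φ)]
  have hAB : S.map φ * T.map φ = -(T.map φ * S.map φ) := by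
    rw [← Matrix.map_mul, hST, Matrix.map_neg _ (map_neg φ), Matrix.map_mul]
  have hAG : (S.map φ)ᵀ * G.map φ * S.map φ = G.map φ := by
    rw [← Matrix.transpose_map, ← Matrix.map_mul, ← Matrix.map_mul, hSG]
  have hBG : (T.map φ)ᵀ * G.map φ * T.map φ = G.map φ := by
    rw [← Matrix.transpose_map, ← Matrix.map_mul, ← Matrix.map_mul, hTG]
  have hGt' : (G.map φ)ᵀ = G.map φ := by rw [← Matrix.transpose_map, hGt]
  have hG' : IsUnit (G.map φ).det := by
    have h := RingHom.map_det φ G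
    rw [RingHom.mapMatrix_apply] at h
    rw [← h]
    exact hG.map φ
  have hspanC := mem_span_taggedContraction_of_cayley_commutator_matrices (K := ℂ) (m := m) (S.map φ) (T.map φ) (G.map φ)
    (i := Complex.I) hA hB hAB hAG hBG hGt' hG' Complex.I_mul_I (fun w => φ (s w))
    (fun g h hg1 hh1 hgS hhS hgT hhT hgG hhG => hasc g h hg1 hh1 hgS hhS hgT hhT hgG hhG)
  -- descent `ℂ → ℚ`
  refine mem_span_of_algebraMap_mem_span _ s ?_
  refine Submodule.span_mono ?_ hspanC
  rintro f ⟨j, e, δ, rfl⟩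
  refine ⟨taggedContraction (fun d : Fin 4 => (![(1 : Matrix (Fin n) (Fin n) ℚ), S, T, S * T] : Fin 4 → _) d * G⁻¹) e δ,
    ⟨j, e, δ, rfl⟩, ?_⟩
  show (fun v => φ (taggedContraction _ e δ v)) = _
  rw [← taggedContraction_map φ]
  congr 1
  funext d
  rw [Matrix.map_mul, vecCons_map, map_inv_of_isUnit φ hG]

end Summit.HodgeConjecture.HodgeConjecture.Theorems.Q8SymplecticPowersQuaternionicSliceSpan

end
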